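import Mathlib
import Literature.Analysis.FluidPDE.GaussianVortexPlanar
import Literature.Analysis.FluidPDE.GaussianVortexPlanarProofs
import Literature.Analysis.FluidPDE.BiotSavart2DSymmetry
import Literature.Analysis.Calculus.IntervalCauchySchwarz
import Summits.AnomalousDissipation.AnomalousDissipation.Theorems.MarginalStabilityChainStretchedVortexRowsStubCoreInverseTools
import Summits.AnomalousDissipation.AnomalousDissipation.Theorems.MarginalStabilityChainStretchedVortexRowsStubCoreInverseAngular
import Summits.AnomalousDissipation.AnomalousDissipation.Theorems.MarginalStabilityChainStretchedVortexRowsStubCoreInverseBurgersPhi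
import HarnessLib

/-!
# Tools for the helper `coreStrain_pairing_bounds` toward stub `stub_coreInverse` of the line
# `braid-closed-large-circulation-gluing` (crux stmt-AnomalousDissipation-3009, `MarginalStabilityChain.StretchedVortexRows`)

Elementary ingredients of the two strain-pairing bounds of the energy method for the cut-off core operator at the
Gaussian vortex `G` (`Sw = χ Bξ·∇w + (∇χ·Bξ) w`, `Bξ = (b₁ξ₀ + b₂ξ₁, b₂ξ₀ − b₁ξ₁)` trace-free, `|B| ≤ β`,
`χ` a radial cut-off at radius `R`, `Ω = (8π)⁻¹φ(|ξ|²/4)` the angular velocity of the vortex):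

* `abs_integral_mul_le_sqrt_mul_sqrt_weighted` (registered helper): the weighted Cauchy–Schwarz inequality
  `|∫ P₁P₂| ≤ (∫ P₁²/W)^{1/2} (∫ W P₂²)^{1/2}` for a positive weight `W`, proved WITHOUT `L²` machinery from the
  pointwise `2|P₁P₂| ≤ t P₁²/W + W P₂²/t` and the optimisation in `t > 0` (tree `le_sqrt_mul_sqrt_of_forall_pos`);
* `one_le_mul_omega_of_norm_le`: `Ω ≥ 1/(64R²)` on the ball `|ξ| ≤ 2R` (`φ(t) ≥ 1/(1+t)`, i.e. `e^{−t}(1+t) ≤ 1`);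
* the algebra of the strain: `⟪ξ, Bξ⟫ = b₁(ξ₀² − ξ₁²) + 2b₂ξ₀ξ₁ = ∂_θ q` for the quadratic potential
  `q = b₁ξ₀ξ₁ + (b₂/2)(ξ₁² − ξ₀²)` (`∂_θ = D(·)[ξ^⊥]`), `‖Bξ‖ ≤ β|ξ|`, `|q| ≤ β|ξ|²/2`;
* `integral_radial_mul_strain_mul_sq`: the angular integration by parts `∫ ρ ⟪ξ,Bξ⟫ w² = −2∫ ρ q w ∂_θw` for a radial
  weight `ρ ∈ C¹_c` (landed `integral_fderiv_perp_eq_zero`, `fderiv_perp_eq_zero_of_radial`);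
* `exists_sqProfile_of_radial`: a smooth radial plateau function is `χ(ξ) = ψ(|ξ|²)` with `ψ ∈ C^∞(ℝ)` and
  `Dχ(ξ) = 2ψ′(|ξ|²)⟪ξ, ·⟫` — which makes `∇χ ∥ ξ` and the conjugated potential `(ψ′ − ψ/4)⟪ξ, Bξ⟫` explicit;
* the scalar inequalities of the final bookkeeping (constants `40 = 2·(5/2)·√64`, `80 ≥ √(68·64)`), kept as separate
  lemmas so that the large context of the main proof never meets nonlinear arithmetic.

References: Th. Gallay, C. E. Wayne, Comm. Math. Phys. 255 (2005) §4; Th. Gallay, Y. Maekawa, arXiv:1610.08384 §4.1.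
-/

set_option linter.dupNamespace false

noncomputable section

open scoped RealInnerProductSpace Topology ContDiff
open MeasureTheory WithLp Function Metric Filter Set

namespace Summit.AnomalousDissipation.AnomalousDissipation.Theorems.MarginalStabilityChainStretchedVortexRows

open Literature.Analysis.FluidPDE

/-! ### Weighted Cauchy–Schwarz -/

/-- **Weighted Cauchy–Schwarz for a pairing**: for a positive weight `W`,
`|∫ P₁ P₂| ≤ (∫ P₁²/W)^{1/2} (∫ W P₂²)^{1/2}` (proved from `2|P₁P₂| ≤ t P₁²/W + W P₂²/t`, `t > 0`). [folklore] -/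
theorem abs_integral_mul_le_sqrt_mul_sqrt_weighted :
    ∀ (P₁ P₂ W : EuclideanSpace ℝ (Fin 2) → ℝ), (∀ ξ, 0 < W ξ) →
      Integrable (fun ξ => P₁ ξ ^ 2 / W ξ) → Integrable (fun ξ => W ξ * P₂ ξ ^ 2) →
      |∫ ξ, P₁ ξ * P₂ ξ| ≤ Real.sqrt (∫ ξ, P₁ ξ ^ 2 / W ξ) * Real.sqrt (∫ ξ, W ξ * P₂ ξ ^ 2) := by
  intro P₁ P₂ W hW hA hB
  have hA0 : 0 ≤ ∫ ξ, P₁ ξ ^ 2 / W ξ := integral_nonneg fun ξ => div_nonneg (sq_nonneg _) (hW ξ).le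
  have hB0 : 0 ≤ ∫ ξ, W ξ * P₂ ξ ^ 2 := integral_nonneg fun ξ => mul_nonneg (hW ξ).le (sq_nonneg _)
  by_cases hint : Integrable fun ξ => P₁ ξ * P₂ ξ
  swap
  · rw [integral_undef hint, abs_zero]; positivity
  refine Literature.Analysis.Calculus.le_sqrt_mul_sqrt_of_forall_pos hA0 hB0 fun t ht => ?_
  have hpt : ∀ ξ, 2 * |P₁ ξ * P₂ ξ| ≤ t * (P₁ ξ ^ 2 / W ξ) + W ξ * P₂ ξ ^ 2 / t := by
    intro ξ
    have hW' := hW ξ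
    have hs0 : 0 < t / W ξ := div_pos ht hW'
    have key : 2 * |P₁ ξ| * |P₂ ξ| ≤ t / W ξ * P₁ ξ ^ 2 + P₂ ξ ^ 2 / (t / W ξ) := by
      rw [show t / W ξ * P₁ ξ ^ 2 + P₂ ξ ^ 2 / (t / W ξ) =
          ((t / W ξ) ^ 2 * |P₁ ξ| ^ 2 + |P₂ ξ| ^ 2) / (t / W ξ) by
            rw [sq_abs, sq_abs]; field_simp]
      rw [le_div_iff₀ hs0]
      nlinarith [sq_nonneg (t / W ξ * |P₁ ξ| - |P₂ ξ|)]
    calc 2 * |P₁ ξ * P₂ ξ| = 2 * |P₁ ξ| * |P₂ ξ| := by rw [abs_mul, mul_assoc]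
      _ ≤ t / W ξ * P₁ ξ ^ 2 + P₂ ξ ^ 2 / (t / W ξ) := key
      _ = t * (P₁ ξ ^ 2 / W ξ) + W ξ * P₂ ξ ^ 2 / t := by field_simp
  have h1 : |∫ ξ, P₁ ξ * P₂ ξ| ≤ ∫ ξ, |P₁ ξ * P₂ ξ| := abs_integral_le_integral_abs
  have h2 : ∫ ξ, 2 * |P₁ ξ * P₂ ξ| ≤ ∫ ξ, (t * (P₁ ξ ^ 2 / W ξ) + W ξ * P₂ ξ ^ 2 / t) :=
    integral_mono (hint.abs.const_mul 2) ((hA.const_mul t).add (hB.div_const t)) hpt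
  rw [integral_const_mul, integral_add (hA.const_mul t) (hB.div_const t), integral_const_mul,
    integral_div] at h2
  linarith

/-! ### The angular velocity on the support of the cut-off -/

/-- `1/(1+t) ≤ φ(t)` for `t ≥ 0` (equivalently `e^{−t}(1+t) ≤ 1`). [folklore] -/
theorem one_div_one_add_le_burgersPhi {t : ℝ} (ht : 0 ≤ t) : 1 / (1 + t) ≤ burgersPhi t := by
  rcases ht.eq_or_lt with rfl | ht'
  · simp
  · rw [burgersPhi_of_ne_zero ht'.ne', div_le_div_iff₀ (by linarith) ht', one_mul]
    have := exp_neg_mul_one_add_le_one t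
    nlinarith [Real.exp_pos (-t)]

/-- On the ball of radius `2R`, `R ≥ 1`, the angular velocity `Ω = (8π)⁻¹φ(|ξ|²/4)` of the Gaussian vortex satisfies
`1 ≤ 64 R² Ω(ξ)` (`φ(t) ≥ 1/(1+t)`, `π ≤ 4`). [folklore] -/
theorem one_le_mul_omega_of_norm_le {R : ℝ} (hR : 1 ≤ R) {ξ : EuclideanSpace ℝ (Fin 2)} (hξ : ‖ξ‖ ≤ 2 * R) :
    1 ≤ 64 * R ^ 2 * ((8 * Real.pi)⁻¹ * burgersPhi (‖ξ‖ ^ 2 / 4)) := by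
  have hφ : 1 / (1 + R ^ 2) ≤ burgersPhi (‖ξ‖ ^ 2 / 4) := by
    refine le_trans ?_ (one_div_one_add_le_burgersPhi (by positivity))
    apply one_div_le_one_div_of_le (by positivity)
    nlinarith [norm_nonneg ξ]
  have hπ := Real.pi_le_four
  have hπ0 := Real.pi_pos
  have hkey : 8 * Real.pi * (1 + R ^ 2) ≤ 64 * R ^ 2 := by nlinarith
  calc (1 : ℝ) = 8 * Real.pi * (1 + R ^ 2) * ((8 * Real.pi)⁻¹ * (1 / (1 + R ^ 2))) := by
        field_simp
    _ ≤ 64 * R ^ 2 * ((8 * Real.pi)⁻¹ * (1 / (1 + R ^ 2))) := by gcongr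
    _ ≤ 64 * R ^ 2 * ((8 * Real.pi)⁻¹ * burgersPhi (‖ξ‖ ^ 2 / 4)) := by gcongr

/-! ### Algebra of the trace-free strain and its quadratic potential -/

/-- The trace-free strain paired with the position: `⟪ξ, Bξ⟫ = b₁(ξ₀² − ξ₁²) + 2b₂ξ₀ξ₁`. [folklore] -/
theorem inner_strain_self (b₁ b₂ : ℝ) (ξ : EuclideanSpace ℝ (Fin 2)) :
    ⟪ξ, toLp 2 ![b₁ * ξ 0 + b₂ * ξ 1, b₂ * ξ 0 - b₁ * ξ 1]⟫ =
      b₁ * (ξ 0 ^ 2 - ξ 1 ^ 2) + 2 * b₂ * ξ 0 * ξ 1 := by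
  rw [inner_fin_two]
  simp
  ring

/-- `‖Bξ‖ ≤ β‖ξ‖` when `b₁² + b₂² ≤ β²` (`‖Bξ‖² = (b₁² + b₂²)|ξ|²`). [folklore] -/
theorem norm_strain_le {b₁ b₂ β : ℝ} (hβ : 0 ≤ β) (hb : b₁ ^ 2 + b₂ ^ 2 ≤ β ^ 2)
    (ξ : EuclideanSpace ℝ (Fin 2)) :
    ‖toLp 2 ![b₁ * ξ 0 + b₂ * ξ 1, b₂ * ξ 0 - b₁ * ξ 1]‖ ≤ β * ‖ξ‖ := by
  have h1 : ‖toLp 2 ![b₁ * ξ 0 + b₂ * ξ 1, b₂ * ξ 0 - b₁ * ξ 1]‖ ^ 2 =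
      (b₁ ^ 2 + b₂ ^ 2) * ‖ξ‖ ^ 2 := by
    rw [EuclideanSpace.norm_sq_eq, EuclideanSpace.norm_sq_eq, Fin.sum_univ_two, Fin.sum_univ_two]
    simp only [Real.norm_eq_abs, sq_abs]
    simp
    ring
  have h2 : ‖toLp 2 ![b₁ * ξ 0 + b₂ * ξ 1, b₂ * ξ 0 - b₁ * ξ 1]‖ ^ 2 ≤ (β * ‖ξ‖) ^ 2 := by
    rw [h1, mul_pow]
    exact mul_le_mul_of_nonneg_right hb (sq_nonneg _)
  have := abs_le_of_sq_le_sq h2 (by positivity)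
  rwa [abs_norm] at this

/-- The quadratic potential `q(ξ) = b₁ξ₀ξ₁ + (b₂/2)(ξ₁² − ξ₀²)` of the strain: `|q(ξ)| ≤ β|ξ|²/2`. [folklore] -/
theorem abs_strainPotential_le {b₁ b₂ β : ℝ} (hβ : 0 ≤ β) (hb : b₁ ^ 2 + b₂ ^ 2 ≤ β ^ 2)
    (ξ : EuclideanSpace ℝ (Fin 2)) :
    |b₁ * ξ 0 * ξ 1 + b₂ / 2 * (ξ 1 ^ 2 - ξ 0 ^ 2)| ≤ β * ‖ξ‖ ^ 2 / 2 := by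
  have hn : ‖ξ‖ ^ 2 = ξ 0 ^ 2 + ξ 1 ^ 2 := by
    rw [EuclideanSpace.norm_sq_eq, Fin.sum_univ_two]
    simp only [Real.norm_eq_abs, sq_abs]
  have h2 : (b₁ * ξ 0 * ξ 1 + b₂ / 2 * (ξ 1 ^ 2 - ξ 0 ^ 2)) ^ 2 ≤ (β * ‖ξ‖ ^ 2 / 2) ^ 2 := by
    rw [hn]
    have hcs : (b₁ * ξ 0 * ξ 1 + b₂ / 2 * (ξ 1 ^ 2 - ξ 0 ^ 2)) ^ 2 ≤
        (b₁ ^ 2 + b₂ ^ 2) * ((ξ 0 ^ 2 + ξ 1 ^ 2) / 2) ^ 2 := by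
      nlinarith [sq_nonneg (b₁ * (ξ 1 ^ 2 - ξ 0 ^ 2) / 2 - b₂ * ξ 0 * ξ 1)]
    calc _ ≤ (b₁ ^ 2 + b₂ ^ 2) * ((ξ 0 ^ 2 + ξ 1 ^ 2) / 2) ^ 2 := hcs
      _ ≤ β ^ 2 * ((ξ 0 ^ 2 + ξ 1 ^ 2) / 2) ^ 2 := mul_le_mul_of_nonneg_right hb (sq_nonneg _)
      _ = (β * (ξ 0 ^ 2 + ξ 1 ^ 2) / 2) ^ 2 := by ring
  exact abs_le_of_sq_le_sq h2 (by positivity)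

/-- `q` is smooth and its angular derivative is the strain form: `Dq(ξ)[ξ^⊥] = ⟪ξ, Bξ⟫ = b₁(ξ₀² − ξ₁²) + 2b₂ξ₀ξ₁`.
[folklore] -/
theorem hasFDerivAt_strainPotential (b₁ b₂ : ℝ) (ξ : EuclideanSpace ℝ (Fin 2)) :
    HasFDerivAt (fun ξ : EuclideanSpace ℝ (Fin 2) => b₁ * ξ 0 * ξ 1 + b₂ / 2 * (ξ 1 ^ 2 - ξ 0 ^ 2))
      ((b₁ * ξ 1 - b₂ * ξ 0) • EuclideanSpace.proj (𝕜 := ℝ) (0 : Fin 2) +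
        (b₁ * ξ 0 + b₂ * ξ 1) • EuclideanSpace.proj (𝕜 := ℝ) (1 : Fin 2)) ξ := by
  have h0 : HasFDerivAt (fun ξ : EuclideanSpace ℝ (Fin 2) => ξ 0) (EuclideanSpace.proj (𝕜 := ℝ) (0 : Fin 2)) ξ :=
    (EuclideanSpace.proj (𝕜 := ℝ) (0 : Fin 2)).hasFDerivAt
  have h1 : HasFDerivAt (fun ξ : EuclideanSpace ℝ (Fin 2) => ξ 1) (EuclideanSpace.proj (𝕜 := ℝ) (1 : Fin 2)) ξ :=
    (EuclideanSpace.proj (𝕜 := ℝ) (1 : Fin 2)).hasFDerivAt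
  have h := ((h0.const_mul b₁).fun_mul h1).fun_add (((h1.pow 2).fun_sub (h0.pow 2)).const_mul (b₂ / 2))
  refine h.congr_fderiv ?_
  ext v
  simp only [add_apply, smul_apply, smul_eq_mul, sub_apply]
  simp
  ring

/-- The quadratic strain potential `q` is smooth (a polynomial in the coordinates). [folklore] -/
theorem contDiff_strainPotential (b₁ b₂ : ℝ) {n : WithTop ℕ∞} :
    ContDiff ℝ n (fun ξ : EuclideanSpace ℝ (Fin 2) => b₁ * ξ 0 * ξ 1 + b₂ / 2 * (ξ 1 ^ 2 - ξ 0 ^ 2)) := by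
  have h0 : ContDiff ℝ n (fun ξ : EuclideanSpace ℝ (Fin 2) => ξ 0) := (EuclideanSpace.proj (𝕜 := ℝ) (0 : Fin 2)).contDiff
  have h1 : ContDiff ℝ n (fun ξ : EuclideanSpace ℝ (Fin 2) => ξ 1) := (EuclideanSpace.proj (𝕜 := ℝ) (1 : Fin 2)).contDiff
  exact ((contDiff_const.mul h0).mul h1).add (contDiff_const.mul ((h1.pow 2).sub (h0.pow 2)))

/-- `∂_θ q(ξ) = Dq(ξ)[ξ^⊥] = b₁(ξ₀² − ξ₁²) + 2b₂ξ₀ξ₁ = ⟪ξ, Bξ⟫`. [folklore] -/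
theorem fderiv_strainPotential_perp (b₁ b₂ : ℝ) (ξ : EuclideanSpace ℝ (Fin 2)) :
    fderiv ℝ (fun ξ : EuclideanSpace ℝ (Fin 2) => b₁ * ξ 0 * ξ 1 + b₂ / 2 * (ξ 1 ^ 2 - ξ 0 ^ 2)) ξ (perp ξ) =
      b₁ * (ξ 0 ^ 2 - ξ 1 ^ 2) + 2 * b₂ * ξ 0 * ξ 1 := by
  rw [(hasFDerivAt_strainPotential b₁ b₂ ξ).fderiv]
  simp only [add_apply, smul_apply, smul_eq_mul]
  simp [perp]
  ring

/-! ### Angular integration by parts against the strain potential -/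

/-- **Angular integration by parts against the strain potential.** For a radial weight `ρ ∈ C¹_c(ℝ²)` and `w ∈ C¹(ℝ²)`,
`∫ ρ ⟪ξ, Bξ⟫ w² = ∫ ρ (∂_θ q) w² = −2 ∫ ρ q w ∂_θw` (`∂_θ = D(·)[ξ^⊥]`, `∂_θρ = 0`, `∫ ∂_θ(ρ q w²) = 0`). [folklore] -/
theorem integral_radial_mul_strain_mul_sq (b₁ b₂ : ℝ) {ρ w : EuclideanSpace ℝ (Fin 2) → ℝ} (hρ : ContDiff ℝ 1 ρ)
    (hρc : HasCompactSupport ρ) (hrad : ∀ ξ η : EuclideanSpace ℝ (Fin 2), ‖ξ‖ = ‖η‖ → ρ ξ = ρ η)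
    (hw : ContDiff ℝ 1 w) :
    ∫ ξ, ρ ξ * (b₁ * (ξ 0 ^ 2 - ξ 1 ^ 2) + 2 * b₂ * ξ 0 * ξ 1) * w ξ ^ 2 =
      -2 * ∫ ξ, ρ ξ * (b₁ * ξ 0 * ξ 1 + b₂ / 2 * (ξ 1 ^ 2 - ξ 0 ^ 2)) * w ξ * fderiv ℝ w ξ (perp ξ) := by
  set q : EuclideanSpace ℝ (Fin 2) → ℝ := fun ξ => b₁ * ξ 0 * ξ 1 + b₂ / 2 * (ξ 1 ^ 2 - ξ 0 ^ 2) with hq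
  have hqC : ContDiff ℝ 1 q := contDiff_strainPotential b₁ b₂
  set h : EuclideanSpace ℝ (Fin 2) → ℝ := fun ξ => ρ ξ * (q ξ * w ξ ^ 2) with hh
  have hhC : ContDiff ℝ 1 h := hρ.mul (hqC.mul (hw.pow 2))
  have hhc : HasCompactSupport h := hρc.mul_right
  have hh' : ∀ ξ, fderiv ℝ h ξ (perp ξ) =
      ρ ξ * (b₁ * (ξ 0 ^ 2 - ξ 1 ^ 2) + 2 * b₂ * ξ 0 * ξ 1) * w ξ ^ 2 +
        2 * (ρ ξ * q ξ * w ξ * fderiv ℝ w ξ (perp ξ)) := by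
    intro ξ
    have hρd := (hρ.differentiable one_ne_zero ξ).hasFDerivAt
    have hqd := (hqC.differentiable one_ne_zero ξ).hasFDerivAt
    have hwd : HasFDerivAt (fun η => w η ^ 2) ((2 * w ξ) • fderiv ℝ w ξ) ξ := by
      simpa using ((hw.differentiable one_ne_zero ξ).hasFDerivAt).pow 2
    rw [hh, (hρd.fun_mul (hqd.fun_mul hwd)).fderiv]
    simp only [add_apply, smul_apply, smul_eq_mul, fderiv_perp_eq_zero_of_radial hrad ξ, hq,
      fderiv_strainPotential_perp]
    ring
  have hint0 : Integrable fun x => ‖x‖ * h x :=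
    (continuous_norm.mul hhC.continuous).integrable_of_hasCompactSupport hhc.mul_left
  have hint1 : Integrable fun x => ‖x‖ * ‖fderiv ℝ h x‖ :=
    (continuous_norm.mul (hhC.continuous_fderiv one_ne_zero).norm).integrable_of_hasCompactSupport
      (hhc.fderiv (𝕜 := ℝ)).norm.mul_left
  have key := integral_fderiv_perp_eq_zero h hhC hint0 hint1
  have hpoly : Continuous fun ξ : EuclideanSpace ℝ (Fin 2) => b₁ * (ξ 0 ^ 2 - ξ 1 ^ 2) + 2 * b₂ * ξ 0 * ξ 1 := by
    fun_prop
  have hiA : Integrable fun ξ => ρ ξ * (b₁ * (ξ 0 ^ 2 - ξ 1 ^ 2) + 2 * b₂ * ξ 0 * ξ 1) * w ξ ^ 2 :=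
    ((hρ.continuous.mul hpoly).mul (hw.continuous.pow 2)).integrable_of_hasCompactSupport
      hρc.mul_right.mul_right
  have hiB : Integrable fun ξ => 2 * (ρ ξ * q ξ * w ξ * fderiv ℝ w ξ (perp ξ)) :=
    ((((hρ.continuous.mul hqC.continuous).mul hw.continuous).mul
      ((hw.continuous_fderiv one_ne_zero).clm_apply continuous_perp)).integrable_of_hasCompactSupport
      hρc.mul_right.mul_right.mul_right).const_mul 2
  rw [integral_congr_ae (Eventually.of_forall hh'), integral_add hiA hiB, integral_const_mul] at key
  linarith

/-! ### The square-radius profile of a radial cut-off -/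

/-- **Square-radius profile of a smooth radial plateau function.** If `χ ∈ C^∞(ℝ²)` is radial and `χ = 1` on the
closed ball of radius `R > 0`, then `χ(ξ) = ψ(|ξ|²)` for the smooth profile `ψ(s) = χ(√s e₀)` (constant `= 1` on
`s < R²`, so the square root costs no regularity), and `Dχ(ξ) = 2ψ′(|ξ|²)⟪ξ, ·⟫`. [folklore] -/
theorem exists_sqProfile_of_radial :
    ∀ (R : ℝ) (χ : EuclideanSpace ℝ (Fin 2) → ℝ), 0 < R → ContDiff ℝ ∞ χ →
      (∀ ξ η, ‖ξ‖ = ‖η‖ → χ ξ = χ η) → (∀ ξ, ‖ξ‖ ≤ R → χ ξ = 1) →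
      ∃ ψ : ℝ → ℝ, ContDiff ℝ ∞ ψ ∧ (∀ s, ψ s = χ (Real.sqrt s • EuclideanSpace.single 0 1)) ∧
        (∀ ξ, χ ξ = ψ (‖ξ‖ ^ 2)) ∧
        ∀ ξ, HasFDerivAt χ ((2 * deriv ψ (‖ξ‖ ^ 2)) • innerSL ℝ ξ) ξ := by
  intro R χ hR hχ hrad h1
  set e : EuclideanSpace ℝ (Fin 2) := EuclideanSpace.single 0 1 with he
  have hne : ‖e‖ = 1 := by simp [he]
  have hnorm : ∀ s, ‖Real.sqrt s • e‖ = Real.sqrt s := fun s => by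
    rw [norm_smul, hne, mul_one, Real.norm_of_nonneg (Real.sqrt_nonneg s)]
  -- smoothness: locally constant near `s < R²`, a composition with the smooth square root near `s > 0`
  have hψC : ContDiff ℝ ∞ fun s => χ (Real.sqrt s • e) := by
    refine contDiff_iff_contDiffAt.2 fun s => ?_
    by_cases hs : s < R ^ 2
    · have hev : (fun s => χ (Real.sqrt s • e)) =ᶠ[𝓝 s] fun _ => (1 : ℝ) := by
        filter_upwards [Iio_mem_nhds hs] with s' hs'
        refine h1 _ ?_
        rw [hnorm]
        calc Real.sqrt s' ≤ Real.sqrt (R ^ 2) := Real.sqrt_le_sqrt hs'.le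
          _ = R := Real.sqrt_sq hR.le
      exact contDiffAt_const.congr_of_eventuallyEq hev
    · have hs0 : s ≠ 0 := by
        intro h0; rw [h0] at hs; exact hs (by positivity)
      exact hχ.contDiffAt.comp s ((Real.contDiffAt_sqrt hs0).smul contDiffAt_const)
  have hcomp : ∀ η, χ η = (fun s => χ (Real.sqrt s • e)) (‖η‖ ^ 2) := fun η => by
    refine hrad _ _ ?_
    rw [hnorm, Real.sqrt_sq (norm_nonneg η)]
  refine ⟨fun s => χ (Real.sqrt s • e), hψC, fun s => rfl, hcomp, fun ξ => ?_⟩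
  have hd : HasDerivAt (fun s => χ (Real.sqrt s • e)) (deriv (fun s => χ (Real.sqrt s • e)) (‖ξ‖ ^ 2))
      (‖ξ‖ ^ 2) :=
    ((hψC.differentiable (by simp)) _).hasDerivAt
  have h := hd.comp_hasFDerivAt ξ (hasStrictFDerivAt_norm_sq ξ).hasFDerivAt
  refine (h.congr_of_eventuallyEq (Eventually.of_forall fun η => hcomp η)).congr_fderiv ?_
  ext v
  simp only [smul_apply, smul_eq_mul]
  ring


/-! ### Scalar inequalities (kept out of the main proof, whose context is large) -/

/-- `2R < r`, `R > 0` ⇒ `4R² < r²`. [folklore] -/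
theorem four_mul_sq_lt_sq {R r : ℝ} (hR : 0 < R) (h : 2 * R < r) : 4 * R ^ 2 < r ^ 2 := by
  nlinarith

/-- `G⁻¹ (G u)² = G u²`. [folklore] -/
theorem inv_mul_mul_sq {G u : ℝ} (hG : G ≠ 0) : G⁻¹ * (G * u) ^ 2 = G * u ^ 2 := by
  field_simp

/-- The size of the conjugated strain potential `Q = (ψ′ − ψ/4) q` on the support of the cut-off:
`|ψ′| r ≤ 2/R`, `0 ≤ ψ ≤ 1`, `|q| ≤ β r²/2`, `r ≤ 2R`, `R ≥ 1` ⇒ `|Q| ≤ (5/2) β R²`. [folklore] -/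
theorem abs_sub_div_four_mul_le {β R r d p Q : ℝ} (hβ : 0 ≤ β) (hR : 1 ≤ R) (hr0 : 0 ≤ r) (hr : r ≤ 2 * R)
    (hd : 2 * |d| * r ≤ 4 / R) (hp0 : 0 ≤ p) (hp1 : p ≤ 1) (hQ : |Q| ≤ β * r ^ 2 / 2) :
    |(d - p / 4) * Q| ≤ 5 / 2 * β * R ^ 2 := by
  have hR0 : 0 < R := by linarith
  have hm_abs : |d - p / 4| ≤ |d| + 1 / 4 := by
    refine (abs_sub _ _).trans ?_
    rw [abs_of_nonneg (by linarith : (0 : ℝ) ≤ p / 4)]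
    linarith
  have hdr : |d| * r ≤ 2 / R := by
    rw [show (2 : ℝ) / R = (4 / R) / 2 by ring]
    linarith
  have hβR : 2 * β ≤ 2 * β * R ^ 2 := by
    have : 2 * β * 1 ≤ 2 * β * R ^ 2 := mul_le_mul_of_nonneg_left (by nlinarith) (by positivity)
    linarith
  rw [abs_mul]
  calc |d - p / 4| * |Q| ≤ (|d| + 1 / 4) * (β * r ^ 2 / 2) := mul_le_mul hm_abs hQ (abs_nonneg _) (by positivity)
    _ = |d| * r * (β * r) / 2 + β * r ^ 2 / 8 := by ring
    _ ≤ 2 / R * (β * (2 * R)) / 2 + β * (2 * R) ^ 2 / 8 := by gcongr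
    _ = 2 * β * (R * R⁻¹) + β * R ^ 2 / 2 := by ring
    _ = 2 * β + β * R ^ 2 / 2 := by rw [mul_inv_cancel₀ hR0.ne', mul_one]
    _ ≤ 2 * β * R ^ 2 + β * R ^ 2 / 2 := by linarith
    _ = 5 / 2 * β * R ^ 2 := by ring

/-- Pointwise bound behind `|⟨Sw, ∂_θw⟩| ≤ 80βR²‖w‖_Y Θ^{1/2}`: with `Gi = G⁻¹`, `1 ≤ 64R²Ω`,
`|S| ≤ 2βR a + 8β|b|` ⇒ `(Gi S)²/(Gi Ω) ≤ (80βR²)² Gi (b² + a²)` (`68 · 64 ≤ 6400`). [folklore] -/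
theorem strain_pointwise_dtheta {Gi Ω S a b β R : ℝ} (hGi : 0 < Gi) (hΩ : 0 < Ω) (hΩ1 : 1 ≤ 64 * R ^ 2 * Ω)
    (hR : 1 ≤ R) (hS : |S| ≤ 2 * β * R * a + 8 * β * |b|) :
    (Gi * S) ^ 2 / (Gi * Ω) ≤ (80 * β * R ^ 2) ^ 2 * (Gi * (b ^ 2 + a ^ 2)) := by
  rw [div_le_iff₀ (mul_pos hGi hΩ)]
  have hR2 : 1 ≤ R ^ 2 := by nlinarith
  have i1 : (2 * R * a + 8 * |b|) ^ 2 ≤ 68 * R ^ 2 * (b ^ 2 + a ^ 2) := by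
    have := mul_nonneg (sub_nonneg.2 hR2) (add_nonneg (sq_nonneg b) (sq_nonneg a))
    nlinarith [sq_nonneg (2 * R * |b| - 8 * a), sq_abs b]
  have hS2 : S ^ 2 ≤ β ^ 2 * (68 * R ^ 2 * (b ^ 2 + a ^ 2)) := by
    calc S ^ 2 = |S| ^ 2 := (sq_abs _).symm
      _ ≤ (2 * β * R * a + 8 * β * |b|) ^ 2 := pow_le_pow_left₀ (abs_nonneg _) hS 2
      _ = β ^ 2 * (2 * R * a + 8 * |b|) ^ 2 := by ring
      _ ≤ β ^ 2 * (68 * R ^ 2 * (b ^ 2 + a ^ 2)) := mul_le_mul_of_nonneg_left i1 (sq_nonneg β)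
  have hnn : 0 ≤ β ^ 2 * R ^ 4 * Gi ^ 2 * Ω * (b ^ 2 + a ^ 2) := by positivity
  calc (Gi * S) ^ 2 = Gi ^ 2 * S ^ 2 := by ring
    _ ≤ Gi ^ 2 * (β ^ 2 * (68 * R ^ 2 * (b ^ 2 + a ^ 2))) := by gcongr
    _ = Gi ^ 2 * (β ^ 2 * (68 * R ^ 2 * (b ^ 2 + a ^ 2))) * 1 := by ring
    _ ≤ Gi ^ 2 * (β ^ 2 * (68 * R ^ 2 * (b ^ 2 + a ^ 2))) * (64 * R ^ 2 * Ω) := by gcongr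
    _ = 4352 * (β ^ 2 * R ^ 4 * Gi ^ 2 * Ω * (b ^ 2 + a ^ 2)) := by ring
    _ ≤ 6400 * (β ^ 2 * R ^ 4 * Gi ^ 2 * Ω * (b ^ 2 + a ^ 2)) := mul_le_mul_of_nonneg_right (by norm_num) hnn
    _ = (80 * β * R ^ 2) ^ 2 * (Gi * (b ^ 2 + a ^ 2)) * (Gi * Ω) := by ring

/-- Pointwise bound behind `|⟨Sw, w⟩| ≤ 40βR³‖w‖_X Θ^{1/2}`: with `Gi = G⁻¹`, `1 ≤ 64R²Ω`, `|m q| ≤ (5/2)βR²`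
⇒ `(2 m Gi q w)²/(Gi Ω) ≤ (40βR³)² Gi w²` (`4 · (25/4) · 64 = 1600`). [folklore] -/
theorem strain_pointwise_w {Gi Ω mv q wv β R : ℝ} (hGi : 0 < Gi) (hΩ : 0 < Ω) (hΩ1 : 1 ≤ 64 * R ^ 2 * Ω)
    (hmq : |mv * q| ≤ 5 / 2 * β * R ^ 2) :
    (-2 * (mv * Gi * q * wv)) ^ 2 / (Gi * Ω) ≤ (40 * β * R ^ 3) ^ 2 * (Gi * wv ^ 2) := by
  rw [div_le_iff₀ (mul_pos hGi hΩ)]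
  have hmq2 : (mv * q) ^ 2 ≤ (5 / 2 * β * R ^ 2) ^ 2 := by
    rw [← sq_abs]; exact pow_le_pow_left₀ (abs_nonneg _) hmq 2
  calc (-2 * (mv * Gi * q * wv)) ^ 2 = 4 * Gi ^ 2 * wv ^ 2 * (mv * q) ^ 2 := by ring
    _ ≤ 4 * Gi ^ 2 * wv ^ 2 * (5 / 2 * β * R ^ 2) ^ 2 := by gcongr
    _ = 25 * β ^ 2 * R ^ 4 * Gi ^ 2 * wv ^ 2 * 1 := by ring
    _ ≤ 25 * β ^ 2 * R ^ 4 * Gi ^ 2 * wv ^ 2 * (64 * R ^ 2 * Ω) := by gcongr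
    _ = (40 * β * R ^ 3) ^ 2 * (Gi * wv ^ 2) * (Gi * Ω) := by ring

/-- Pointwise bound of the `Θ`-integrand `G⁻¹ Ω (G ∂_θu)² ≤ (8π)⁻¹ M² (1 + |ξ|)² G`. [folklore] -/
theorem theta_integrand_le {G φ D M r c : ℝ} (hG : 0 < G) (hφ0 : 0 ≤ φ) (hφ1 : φ ≤ 1) (hc : 0 ≤ c)
    (hD : |D| ≤ M * r) (hr : 0 ≤ r) :
    |G⁻¹ * (c * φ) * (G * D) ^ 2| ≤ c * M ^ 2 * ((1 + r) ^ 2 * G) := by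
  have hsq : D ^ 2 ≤ (M * r) ^ 2 := by
    rw [← sq_abs]; exact pow_le_pow_left₀ (abs_nonneg _) hD 2
  have hr2 : r ^ 2 ≤ (1 + r) ^ 2 := by nlinarith
  rw [abs_of_nonneg (by positivity)]
  calc G⁻¹ * (c * φ) * (G * D) ^ 2 = c * φ * G * D ^ 2 := by field_simp
    _ ≤ c * 1 * G * (M * r) ^ 2 := by gcongr
    _ = c * M ^ 2 * (r ^ 2 * G) := by ring
    _ ≤ c * M ^ 2 * ((1 + r) ^ 2 * G) := by gcongr

end Summit.AnomalousDissipation.AnomalousDissipation.Theorems.MarginalStabilityChainStretchedVortexRows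

end
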